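/-
Copyright (c) 2026 the pub-hodgecm-mathlib formalisation cell (harness21).  Prover seat hodgecm-mathlib-K2E5-p17 (g3) (free E5 hand), Track B «K2-LIT»,
#184♮ = hLiu418 = `stmt-HodgeConjecture-24832`; K2E5-plan (g5) DEAL 2026-09-04T05:14:45Z «#33b (a) BIG-CELL OPEN EMBEDDING», file (A):
the block algebra of the doubling MAIN ORBIT `P_Δ · ι(G × 1)` with the open criterion `det(B₂₂ − B₁₂) ≠ 0` (REPORT-FIRST K2 bus 05:3xZ).
-/
import Summits.HodgeConjecture.HodgeConjecture.Theorems.K2LiuDoublingUnfoldMainOrbitBlocks   -- ★ H4a: sesquilinear bookkeeping, `siegel_of_mainOrbit_block`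
import Mathlib.Tactic.NoncommRing
import HarnessLib

/-!
# Crux `HLiu418`, road `K2_Liu`, socket #33b organ (a), file (A): the MAIN ORBIT of the doubling method in block form —
# `B ∈ P_Δ · ι(G × 1) ⟺ B₂₂ − B₁₂` invertible, with the RATIONAL inverse `B ↦ (B · ι(A(B)⁻¹, 1), A(B))`, `A(B) = (B₂₂ − B₁₂)⁻¹ (B₁₁ − B₂₁)`

Cell `hodgecm-mathlib`, crux item hLiu418 = `stmt-HodgeConjecture-24832`; squad K2, dealer K2E5-plan (g5), LEAD F0P6-plan (g11), consumer K2E2-p12 (g3)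
(#33b assembly `sig_K2LiuSiegelBigCellSection`).  THEOREMS ONLY (no `def`, no instance, no notation, no named-fact hypothesis, no `sorry`);
Mathlib-only mathematics on top of ★ H4a `K2LiuDoublingUnfoldMainOrbitBlocks`; lane `--supports stmt-HodgeConjecture-24832 --as helper` (count-neutral).

SETTING (H4a's): a field `L` with a ring endomorphism `c`, a Gram matrix `J ∈ M_ι(L)`, the doubled form `J^𝔻 = J ⊕ −J` on `ι ⊕ ι`, the diagonal
`Δ = {(x,x)}`; block coordinates `B.toBlocks_{ij}`; the SIEGEL condition `P₁₁ + P₁₂ = P₂₁ + P₂₂` (`P` stabilises `Δ`); `ι(X, Y) = fromBlocks X 0 0 Y`.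
Write **`M(B) := B₂₂ − B₁₂`** (spelled out; no definition).  CORRECTION recorded for the #33b words: the doubling main orbit `Ω = P_Δ·ι(G×1) =
P_Δ·ι(G×G)` is `{M(B) invertible}` — it contains `1 = ι(1,1)` and is NOT the big Bruhat cell `P_Δ w_Δ N_Δ` of ★ `K2LiuSiegelBruhatCells`
(whose criterion is the lower-left block of the `Δ`-adapted frame; `ι(g,1)` has that block `1 − g`).

* §1 (any commutative ring) the `M`-CALCULUS: `M(P·B) = M(P)·M(B)` for Siegel `P` (`toBlocks_sub_siegel_mul`), `M(B·ι(X,Y)) = M(B)·Y`, `M(ι(X,Y)) = Y`,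
  `M(1) = 1`; hence `M` is a unit on the Siegel group (`isUnit_toBlocks_sub_of_siegel_mul_eq_one`) and `Ω ⊇ P_Δ·ι(G×1)` (`isUnit_toBlocks_sub_siegel_mul_iota`).
* §2 (field, `J` non-degenerate) ON `{M(B) unit}` for an isometry `B` of `J^𝔻`: `A(B) := M(B)⁻¹(B₁₁ − B₂₁)` is `J`-UNITARY (`unitary_mainOrbitBlock`, H4a's
  argument with «`M` unit» replacing anisotropy), INVERTIBLE (`isUnit_mainOrbitBlock`, determinant of `ᵗ(cA)JA = J`), satisfies `B₁₁ − B₂₁ = M(B)·A(B)`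
  and is the UNIQUE such matrix (`mainOrbitBlock_unique`); `B·ι(A(B)⁻¹,1)` is Siegel (★ `siegel_of_mainOrbit_block`) with unit `M` — so
  **`B = P·ι(A,1)` with `P ∈ P_Δ`, `A ∈ U(J)` iff `M(B)` is a unit** (`exists_siegel_mul_iota_iff_isUnit`), and the decomposition is unique
  (`siegel_mul_iota_unique`): the inverse of `(P, A) ↦ P·ι(A,1)` is the pair of RATIONAL maps `B ↦ (B·ι(A(B)⁻¹,1), A(B))`.
The topological transport (open embedding `P_{Δ,v} × G_v → H_v` at a place: `Ω = {det M ≠ 0}` open, both maps continuous in the entrywise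
topology) is file (B).  [GelbartPiatetskishapiroRallis1987, Part A §1 (orbits of `G × G` on `P\H`; the main orbit, stabiliser `G^Δ`)]
[Liu2021, §B.3 (B.5), Lem. B.11] [HarrisKudlaSweet1996, §1].
HONEST LABEL.  Count-neutral helper; `HC_CM` is proved only modulo the 7 printed citations (2 remaining named inputs: hLiu418 =
`stmt-HodgeConjecture-24832`, h413 = `stmt-HodgeConjecture-24833`) until rung 0 closes.
-/

set_option autoImplicit false
set_option linter.dupNamespace false -- the mandated namespace repeats `HodgeConjecture.HodgeConjecture`

namespace Summit.HodgeConjecture.HodgeConjecture.Cruxes.HLiu418.K2LiuDoublingMainOrbitBlocksUnit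

open Matrix
open Summit.HodgeConjecture.HodgeConjecture.Cruxes.HLiu418.K2LiuDoublingUnfoldMainOrbitBlocks

/-! ## §1 The `M`-calculus: `M(B) = B₂₂ − B₁₂` -/

section Ring

variable {R : Type*} [CommRing R] {m : Type*} [Fintype m] [DecidableEq m]

omit [DecidableEq m] in
/-- **`M(P·B) = M(P)·M(B)` for Siegel `P`** (`P₁₁ + P₁₂ = P₂₁ + P₂₂`). [cite: GelbartPiatetskishapiroRallis1987, Part A §1] -/
theorem toBlocks_sub_siegel_mul (P B : Matrix (m ⊕ m) (m ⊕ m) R) (hP : P.toBlocks₁₁ + P.toBlocks₁₂ = P.toBlocks₂₁ + P.toBlocks₂₂) :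
    (P * B).toBlocks₂₂ - (P * B).toBlocks₁₂ = (P.toBlocks₂₂ - P.toBlocks₁₂) * (B.toBlocks₂₂ - B.toBlocks₁₂) := by
  have hP' : P.toBlocks₂₁ = P.toBlocks₁₁ + P.toBlocks₁₂ - P.toBlocks₂₂ := eq_sub_of_add_eq hP.symm
  conv_lhs => rw [← fromBlocks_toBlocks P, ← fromBlocks_toBlocks B, fromBlocks_multiply]
  rw [toBlocks_fromBlocks₂₂, toBlocks_fromBlocks₁₂, hP']
  noncomm_ring

omit [DecidableEq m] in
/-- `M(B·ι(X,Y)) = M(B)·Y` (`ι(X,Y) = fromBlocks X 0 0 Y`). [cite: GelbartPiatetskishapiroRallis1987, Part A §1] -/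
theorem toBlocks_sub_mul_fromBlocks_diag (B : Matrix (m ⊕ m) (m ⊕ m) R) (X Y : Matrix m m R) :
    (B * fromBlocks X 0 0 Y).toBlocks₂₂ - (B * fromBlocks X 0 0 Y).toBlocks₁₂ = (B.toBlocks₂₂ - B.toBlocks₁₂) * Y := by
  conv_lhs => rw [← fromBlocks_toBlocks B, fromBlocks_multiply]
  rw [toBlocks_fromBlocks₂₂, toBlocks_fromBlocks₁₂, Matrix.mul_zero, Matrix.mul_zero, zero_add, zero_add, sub_mul]

omit [Fintype m] [DecidableEq m] in
/-- `M(ι(X,Y)) = Y`. [folklore] -/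
theorem toBlocks_sub_fromBlocks_diag (X Y : Matrix m m R) :
    (fromBlocks X 0 0 Y : Matrix (m ⊕ m) (m ⊕ m) R).toBlocks₂₂ - (fromBlocks X 0 0 Y).toBlocks₁₂ = Y := by
  rw [toBlocks_fromBlocks₂₂, toBlocks_fromBlocks₁₂, sub_zero]

omit [Fintype m] in
/-- `M(1) = 1`. [folklore] -/
theorem toBlocks_sub_one : (1 : Matrix (m ⊕ m) (m ⊕ m) R).toBlocks₂₂ - (1 : Matrix (m ⊕ m) (m ⊕ m) R).toBlocks₁₂ = 1 := by
  rw [← fromBlocks_one, toBlocks_sub_fromBlocks_diag]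

/-- **`M(P)` is a unit for `P` in the Siegel group**: if `P`, `P′` are Siegel and `P·P′ = 1` then `M(P)` is invertible (`M(P)M(P′) = M(1) = 1`).
[cite: GelbartPiatetskishapiroRallis1987, Part A §1] -/
theorem isUnit_toBlocks_sub_of_siegel_mul_eq_one (P P' : Matrix (m ⊕ m) (m ⊕ m) R)
    (hP : P.toBlocks₁₁ + P.toBlocks₁₂ = P.toBlocks₂₁ + P.toBlocks₂₂) (h : P * P' = 1) :
    IsUnit (P.toBlocks₂₂ - P.toBlocks₁₂) := by
  have h1 := toBlocks_sub_siegel_mul P P' hP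
  rw [h, toBlocks_sub_one] at h1
  rw [isUnit_iff_isUnit_det]
  exact isUnit_iff_exists_inv.2 ⟨(P'.toBlocks₂₂ - P'.toBlocks₁₂).det, by rw [← det_mul, ← h1, det_one]⟩

/-- `Ω ⊇ P_Δ · ι(G × 1)`: `M(P·ι(X,1)) = M(P)` is a unit when `M(P)` is. [cite: GelbartPiatetskishapiroRallis1987, Part A §1] -/
theorem isUnit_toBlocks_sub_siegel_mul_iota (P : Matrix (m ⊕ m) (m ⊕ m) R) (hMP : IsUnit (P.toBlocks₂₂ - P.toBlocks₁₂)) (X : Matrix m m R) :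
    IsUnit ((P * fromBlocks X 0 0 1).toBlocks₂₂ - (P * fromBlocks X 0 0 1).toBlocks₁₂) := by
  rw [toBlocks_sub_mul_fromBlocks_diag, Matrix.mul_one]
  exact hMP

end Ring

/-! ## §2 The main orbit: `M(B)` unit ⟹ `A(B) = M(B)⁻¹(B₁₁ − B₂₁)` is unitary, invertible, unique, and `B·ι(A⁻¹,1)` is Siegel -/

section Main

variable {L : Type*} [Field L] (c : L →+* L) {ι : Type*} [Fintype ι] [DecidableEq ι]

/-- `B₁₁ − B₂₁ = M(B)·A(B)` (the defining identity; `M(B)` a unit). [cite: Liu2021, §B.3 (B.5) p. 101] -/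
theorem sub_eq_toBlocks_sub_mul_mainOrbitBlock (B : Matrix (ι ⊕ ι) (ι ⊕ ι) L) (hM : IsUnit (B.toBlocks₂₂ - B.toBlocks₁₂)) :
    B.toBlocks₁₁ - B.toBlocks₂₁ = (B.toBlocks₂₂ - B.toBlocks₁₂) * ((B.toBlocks₂₂ - B.toBlocks₁₂)⁻¹ * (B.toBlocks₁₁ - B.toBlocks₂₁)) := by
  rw [← Matrix.mul_assoc, mul_nonsing_inv _ ((isUnit_iff_isUnit_det _).1 hM), Matrix.one_mul]

/-- UNIQUENESS: `B₁₁ − B₂₁ = M(B)·A` determines `A` when `M(B)` is a unit. [cite: Liu2021, Lem. B.11 p. 102] -/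
theorem mainOrbitBlock_unique (B : Matrix (ι ⊕ ι) (ι ⊕ ι) L) (hM : IsUnit (B.toBlocks₂₂ - B.toBlocks₁₂)) {A : Matrix ι ι L}
    (hA : B.toBlocks₁₁ - B.toBlocks₂₁ = (B.toBlocks₂₂ - B.toBlocks₁₂) * A) :
    A = (B.toBlocks₂₂ - B.toBlocks₁₂)⁻¹ * (B.toBlocks₁₁ - B.toBlocks₂₁) := by
  rw [hA, ← Matrix.mul_assoc, nonsing_inv_mul _ ((isUnit_iff_isUnit_det _).1 hM), Matrix.one_mul]

/-- **`A(B)` is `J`-UNITARY** for an isometry `B` of `J ⊕ −J` with `M(B)` a unit: `B` carries the graph `{(y, A y)}` INTO `Δ`, and `Δ` is totally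
isotropic, so `⟪A y, A y′⟫ = ⟪y, y′⟫` (H4a's computation, «`M` unit» in place of anisotropy). [cite: Liu2021, §B.3 (B.5) p. 101]
[cite: GelbartPiatetskishapiroRallis1987, Part A §1] -/
theorem unitary_mainOrbitBlock (J : Matrix ι ι L) (B : Matrix (ι ⊕ ι) (ι ⊕ ι) L)
    (hB : (B.map c)ᵀ * Matrix.fromBlocks J 0 0 (-J) * B = Matrix.fromBlocks J 0 0 (-J)) (hM : IsUnit (B.toBlocks₂₂ - B.toBlocks₁₂)) :
    (((B.toBlocks₂₂ - B.toBlocks₁₂)⁻¹ * (B.toBlocks₁₁ - B.toBlocks₂₁)).map c)ᵀ * J *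
        ((B.toBlocks₂₂ - B.toBlocks₁₂)⁻¹ * (B.toBlocks₁₁ - B.toBlocks₂₁)) = J := by
  have hMdet : IsUnit (B.toBlocks₂₂ - B.toBlocks₁₂).det := (isUnit_iff_isUnit_det _).1 hM
  -- `B (u₁, u₂) ∈ Δ` and `B (v₁, v₂) ∈ Δ` force `⟪u₁,v₁⟫ = ⟪u₂,v₂⟫`
  have key : ∀ u₁ u₂ : ι → L, B.toBlocks₁₁ *ᵥ u₁ + B.toBlocks₁₂ *ᵥ u₂ = B.toBlocks₂₁ *ᵥ u₁ + B.toBlocks₂₂ *ᵥ u₂ →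
      ∀ v₁ v₂ : ι → L, B.toBlocks₁₁ *ᵥ v₁ + B.toBlocks₁₂ *ᵥ v₂ = B.toBlocks₂₁ *ᵥ v₁ + B.toBlocks₂₂ *ᵥ v₂ →
      (⇑c ∘ u₁) ⬝ᵥ (J *ᵥ v₁) - (⇑c ∘ u₂) ⬝ᵥ (J *ᵥ v₂) = 0 := by
    intro u₁ u₂ hu v₁ v₂ hv
    have h1 := conj_mulVec_dotProduct_mulVec_of_isometry c hB (Sum.elim u₁ u₂) (Sum.elim v₁ v₂)
    rw [mulVec_sumElim, mulVec_sumElim, hu, hv, doubled_form_diag, doubled_form_sumElim] at h1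
    exact h1.symm
  have hgraph : ∀ y : ι → L,
      B.toBlocks₁₁ *ᵥ y + B.toBlocks₁₂ *ᵥ (((B.toBlocks₂₂ - B.toBlocks₁₂)⁻¹ * (B.toBlocks₁₁ - B.toBlocks₂₁)) *ᵥ y) =
        B.toBlocks₂₁ *ᵥ y + B.toBlocks₂₂ *ᵥ (((B.toBlocks₂₂ - B.toBlocks₁₂)⁻¹ * (B.toBlocks₁₁ - B.toBlocks₂₁)) *ᵥ y) := by
    intro y
    rw [← sub_eq_zero]
    have h2 : B.toBlocks₁₁ *ᵥ y + B.toBlocks₁₂ *ᵥ (((B.toBlocks₂₂ - B.toBlocks₁₂)⁻¹ * (B.toBlocks₁₁ - B.toBlocks₂₁)) *ᵥ y) -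
        (B.toBlocks₂₁ *ᵥ y + B.toBlocks₂₂ *ᵥ (((B.toBlocks₂₂ - B.toBlocks₁₂)⁻¹ * (B.toBlocks₁₁ - B.toBlocks₂₁)) *ᵥ y)) =
        (B.toBlocks₁₁ - B.toBlocks₂₁) *ᵥ y -
          (B.toBlocks₂₂ - B.toBlocks₁₂) *ᵥ (((B.toBlocks₂₂ - B.toBlocks₁₂)⁻¹ * (B.toBlocks₁₁ - B.toBlocks₂₁)) *ᵥ y) := by
      rw [sub_mulVec, sub_mulVec]
      abel
    rw [h2, mulVec_mulVec, ← Matrix.mul_assoc, mul_nonsing_inv _ hMdet, Matrix.one_mul, sub_self]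
  exact conjTranspose_mul_mul_eq_of_forall c J _ fun y y' => by
    have h3 := key y _ (hgraph y) y' _ (hgraph y')
    rw [sub_eq_zero] at h3
    exact h3.symm

omit [DecidableEq ι] in
/-- A `J`-unitary matrix is invertible when `J` is non-degenerate (determinants). [folklore] -/
theorem isUnit_of_unitary {J A : Matrix ι ι L} [DecidableEq ι] (hJ : IsUnit J.det) (hA : (A.map c)ᵀ * J * A = J) : IsUnit A := by
  rw [isUnit_iff_isUnit_det]
  have h := congrArg Matrix.det hA
  rw [det_mul, det_mul, det_transpose] at h
  have h2 : (A.map c).det * A.det * J.det = 1 * J.det := by rw [mul_right_comm, h, one_mul]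
  have h3 : (A.map c).det * A.det = 1 := mul_right_cancel₀ hJ.ne_zero h2
  exact isUnit_iff_exists_inv'.2 ⟨(A.map c).det, h3⟩

/-- **`A(B)` is INVERTIBLE** (`J` non-degenerate). [cite: Liu2021, Lem. B.11 p. 102] -/
theorem isUnit_mainOrbitBlock {J : Matrix ι ι L} (hJ : IsUnit J.det) (B : Matrix (ι ⊕ ι) (ι ⊕ ι) L)
    (hB : (B.map c)ᵀ * Matrix.fromBlocks J 0 0 (-J) * B = Matrix.fromBlocks J 0 0 (-J)) (hM : IsUnit (B.toBlocks₂₂ - B.toBlocks₁₂)) :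
    IsUnit ((B.toBlocks₂₂ - B.toBlocks₁₂)⁻¹ * (B.toBlocks₁₁ - B.toBlocks₂₁)) :=
  isUnit_of_unitary c hJ (unitary_mainOrbitBlock c J B hB hM)

/-- **`B · ι(A(B)⁻¹, 1)` is SIEGEL** (★ H4a `siegel_of_mainOrbit_block`) **with unit `M`** (`= M(B)`). [cite: Liu2021, Lem. B.11 p. 102] -/
theorem siegel_mul_iota_inv_mainOrbitBlock {J : Matrix ι ι L} (hJ : IsUnit J.det) (B : Matrix (ι ⊕ ι) (ι ⊕ ι) L)
    (hB : (B.map c)ᵀ * Matrix.fromBlocks J 0 0 (-J) * B = Matrix.fromBlocks J 0 0 (-J)) (hM : IsUnit (B.toBlocks₂₂ - B.toBlocks₁₂)) :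
    ((B * fromBlocks ((B.toBlocks₂₂ - B.toBlocks₁₂)⁻¹ * (B.toBlocks₁₁ - B.toBlocks₂₁))⁻¹ 0 0 1).toBlocks₁₁ +
        (B * fromBlocks ((B.toBlocks₂₂ - B.toBlocks₁₂)⁻¹ * (B.toBlocks₁₁ - B.toBlocks₂₁))⁻¹ 0 0 1).toBlocks₁₂ =
      (B * fromBlocks ((B.toBlocks₂₂ - B.toBlocks₁₂)⁻¹ * (B.toBlocks₁₁ - B.toBlocks₂₁))⁻¹ 0 0 1).toBlocks₂₁ +
        (B * fromBlocks ((B.toBlocks₂₂ - B.toBlocks₁₂)⁻¹ * (B.toBlocks₁₁ - B.toBlocks₂₁))⁻¹ 0 0 1).toBlocks₂₂) ∧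
    IsUnit ((B * fromBlocks ((B.toBlocks₂₂ - B.toBlocks₁₂)⁻¹ * (B.toBlocks₁₁ - B.toBlocks₂₁))⁻¹ 0 0 1).toBlocks₂₂ -
      (B * fromBlocks ((B.toBlocks₂₂ - B.toBlocks₁₂)⁻¹ * (B.toBlocks₁₁ - B.toBlocks₂₁))⁻¹ 0 0 1).toBlocks₁₂) :=
  ⟨siegel_of_mainOrbit_block B (isUnit_mainOrbitBlock c hJ B hB hM) (sub_eq_toBlocks_sub_mul_mainOrbitBlock B hM),
    by rw [toBlocks_sub_mul_fromBlocks_diag, Matrix.mul_one]; exact hM⟩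

/-- **THE MAIN ORBIT IN BLOCK FORM.**  For an isometry `B` of `J ⊕ −J` (`J` non-degenerate):
`B = P · ι(A, 1)` with `P` Siegel of unit `M(P)` and `A` `J`-unitary **iff** `M(B) = B₂₂ − B₁₂` is a unit.
[cite: GelbartPiatetskishapiroRallis1987, Part A §1] [cite: Liu2021, §B.3 (B.5), Lem. B.11] -/
theorem exists_siegel_mul_iota_iff_isUnit {J : Matrix ι ι L} (hJ : IsUnit J.det) (B : Matrix (ι ⊕ ι) (ι ⊕ ι) L)
    (hB : (B.map c)ᵀ * Matrix.fromBlocks J 0 0 (-J) * B = Matrix.fromBlocks J 0 0 (-J)) :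
    (∃ (P : Matrix (ι ⊕ ι) (ι ⊕ ι) L) (A : Matrix ι ι L),
        P.toBlocks₁₁ + P.toBlocks₁₂ = P.toBlocks₂₁ + P.toBlocks₂₂ ∧ IsUnit (P.toBlocks₂₂ - P.toBlocks₁₂) ∧
          (A.map c)ᵀ * J * A = J ∧ B = P * fromBlocks A 0 0 1) ↔
      IsUnit (B.toBlocks₂₂ - B.toBlocks₁₂) := by
  constructor
  · rintro ⟨P, A, _, hMP, _, rfl⟩
    exact isUnit_toBlocks_sub_siegel_mul_iota P hMP A
  · intro hM
    have hA := isUnit_mainOrbitBlock c hJ B hB hM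
    have hAdet : IsUnit ((B.toBlocks₂₂ - B.toBlocks₁₂)⁻¹ * (B.toBlocks₁₁ - B.toBlocks₂₁)).det := (isUnit_iff_isUnit_det _).1 hA
    refine ⟨B * fromBlocks ((B.toBlocks₂₂ - B.toBlocks₁₂)⁻¹ * (B.toBlocks₁₁ - B.toBlocks₂₁))⁻¹ 0 0 1,
      (B.toBlocks₂₂ - B.toBlocks₁₂)⁻¹ * (B.toBlocks₁₁ - B.toBlocks₂₁),
      (siegel_mul_iota_inv_mainOrbitBlock c hJ B hB hM).1, (siegel_mul_iota_inv_mainOrbitBlock c hJ B hB hM).2,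
      unitary_mainOrbitBlock c J B hB hM, ?_⟩
    rw [Matrix.mul_assoc, fromBlocks_multiply]
    simp only [Matrix.mul_zero, Matrix.zero_mul, add_zero, zero_add, Matrix.mul_one, nonsing_inv_mul _ hAdet, fromBlocks_one, Matrix.mul_one]

/-- **UNIQUENESS of the decomposition `B = P · ι(A, 1)`**: if `P·ι(A,1) = P′·ι(A′,1)` with `P, P′` Siegel, `M(P)` a unit and `A` invertible, then
`A = A′` (and hence `P = P′`): the `G`-coordinate is `A(B)`. [cite: GelbartPiatetskishapiroRallis1987, Part A §1 (stabiliser `G^Δ`)] [cite: Liu2021, Lem. B.11] -/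
theorem siegel_mul_iota_unique {P P' : Matrix (ι ⊕ ι) (ι ⊕ ι) L} {A A' : Matrix ι ι L}
    (hP : P.toBlocks₁₁ + P.toBlocks₁₂ = P.toBlocks₂₁ + P.toBlocks₂₂) (hP' : P'.toBlocks₁₁ + P'.toBlocks₁₂ = P'.toBlocks₂₁ + P'.toBlocks₂₂)
    (hMP : IsUnit (P.toBlocks₂₂ - P.toBlocks₁₂)) (h : P * fromBlocks A 0 0 1 = P' * fromBlocks A' 0 0 1) :
    A = A' ∧ (IsUnit A → P = P') := by
  -- `M(B)` and `B₁₁ − B₂₁` of `B = P·ι(A,1)`: `M(B) = M(P)`, `B₁₁ − B₂₁ = (P₁₁ − P₂₁)·A = M(P)·A`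
  have hcoord : ∀ (Q : Matrix (ι ⊕ ι) (ι ⊕ ι) L) (X : Matrix ι ι L), Q.toBlocks₁₁ + Q.toBlocks₁₂ = Q.toBlocks₂₁ + Q.toBlocks₂₂ →
      (Q * fromBlocks X 0 0 1).toBlocks₁₁ - (Q * fromBlocks X 0 0 1).toBlocks₂₁ = (Q.toBlocks₂₂ - Q.toBlocks₁₂) * X := by
    intro Q X hQ
    have hQ' : Q.toBlocks₁₁ - Q.toBlocks₂₁ = Q.toBlocks₂₂ - Q.toBlocks₁₂ := by
      rw [sub_eq_sub_iff_add_eq_add, hQ, add_comm]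
    conv_lhs => rw [← fromBlocks_toBlocks Q, fromBlocks_multiply]
    rw [toBlocks_fromBlocks₁₁, toBlocks_fromBlocks₂₁, Matrix.mul_zero, Matrix.mul_zero, add_zero, add_zero, ← sub_mul, hQ']
  have hM : (P * fromBlocks A 0 0 1).toBlocks₂₂ - (P * fromBlocks A 0 0 1).toBlocks₁₂ = P.toBlocks₂₂ - P.toBlocks₁₂ := by
    rw [toBlocks_sub_mul_fromBlocks_diag, Matrix.mul_one]
  have hM' : (P' * fromBlocks A' 0 0 1).toBlocks₂₂ - (P' * fromBlocks A' 0 0 1).toBlocks₁₂ = P'.toBlocks₂₂ - P'.toBlocks₁₂ := by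
    rw [toBlocks_sub_mul_fromBlocks_diag, Matrix.mul_one]
  have hMeq : P.toBlocks₂₂ - P.toBlocks₁₂ = P'.toBlocks₂₂ - P'.toBlocks₁₂ := by rw [← hM, h, hM']
  have h1 := hcoord P A hP
  have h2 := hcoord P' A' hP'
  rw [h, h2, ← hMeq] at h1
  -- cancel the unit `M(P)`
  have hMdet : IsUnit (P.toBlocks₂₂ - P.toBlocks₁₂).det := (isUnit_iff_isUnit_det _).1 hMP
  have hAA : A = A' := by
    have := congrArg (fun X => (P.toBlocks₂₂ - P.toBlocks₁₂)⁻¹ * X) h1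
    simpa only [← Matrix.mul_assoc, nonsing_inv_mul _ hMdet, Matrix.one_mul] using this.symm
  refine ⟨hAA, fun hA => ?_⟩
  subst hAA
  have hAdet : IsUnit A.det := (isUnit_iff_isUnit_det _).1 hA
  have hι : IsUnit (fromBlocks A 0 0 (1 : Matrix ι ι L)).det := by
    rw [det_fromBlocks_zero₂₁, det_one, mul_one]; exact hAdet
  have := congrArg (fun X => X * (fromBlocks A 0 0 (1 : Matrix ι ι L))⁻¹) h
  simpa only [Matrix.mul_assoc, mul_nonsing_inv _ hι, Matrix.mul_one] using this

end Main

end Summit.HodgeConjecture.HodgeConjecture.Cruxes.HLiu418.K2LiuDoublingMainOrbitBlocksUnit
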